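import Summits.QuantumFields.YangMills.Theses.LangevinControlUV
import Summits.QuantumFields.YangMills.Theorems.LangevinControlUVLatticeGapInUVUnitsCStubSeed
import Summits.QuantumFields.YangMills.Theorems.LatticeGapInUVUnitsC.Negative.TendstoLoadBearing

/-!
# Crux `LatticeGapInUVUnitsC` (stmt-QuantumFields-16206): the point-of-use strength certificate of the a-free branch

Line `nested-shell-rho-mixing` (payload slug `Sketch`), skeleton v7 (`Cruxes/LatticeGapInUVUnitsC/Lines/nested_shell_rho_mixing.lean`),
third closing branch (lead c4): the crux BY NAME from the a-free finite-size certificate S6 `stub_fsCertificate`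
("amplitude `N⁸ Cov_{β,(ℤ/8N)⁴}(P_0^{01}, P_{N e₂}^{01}) ≥ u` ⇒ clustering at rate `κ(u)/N` on all tori `S ≥ K·N`")
through the landed seed `AmplitudeRatchet.stub_seed` (p122527) and transfer `stub_fsTransfer` (p142636).

This file (lead c5) measures how far S6 sits above the crux.  `latticeGapInUVUnitsC_iff_fedCertificate`: the crux is
EQUIVALENT to the FED form of S6 — S6 with (i) the femto two-point package of a CONTINUOUS unit map `a` as hypothesis
and (ii) a free volume threshold `S₁(β)` in place of `K·N`.  Direction `⇐` is the landed pipeline (seed + transfer,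
re-run with the free threshold).  Direction `⇒` is new bookkeeping: the crux's own conclusion (rate `c₁ a(β)`) is at
least the certificate's rate `κ/N` at EVERY certified scale, because a certified amplitude `≥ u` at `(β, N)` forces
`N a(β) ≥ s₀(u) > 0` — inside the femto window by the package's UPPER axis clause at `L = 8N`, `n = N`
(`u ≤ C Γ(N a β)`) and the landed tightness `Γ(0⁺) = 0` (`Negative.shape_tendsto_zero_nhdsGT_of_continuous`),
outside it trivially (`N a β > ℓ₀/8`); so `κ := c₁ · min(s₀, ℓ₀/8)` does it, with the crux's `β₂`, `S₁`, `C(A,B)`.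

Consequence for the planner (promote-stub dossier `Cruxes/LatticeGapInUVUnitsC/CERTIFICATE-ITEM.md`): the registered
a-free text S6 exceeds the crux by exactly two syntactic strengthenings — the volume threshold `K·N` (instead of a free
`S₁(β)`) and universality over all `(G, r)` whether or not a package ruler exists — and by nothing else; fed the
package and given a free threshold it IS the crux (this file), so an item in that fed form would be a restatement,
while S6 itself is the clean, strictly stronger, a-free physics statement.
-/

set_option autoImplicit false

open MeasureTheory Filter Topology
open Literature.MathematicalPhysics.QuantumFieldTheory Literature.MathematicalPhysics.QuantumLattice
open Summit.QuantumFields.YangMills.Theses.LangevinControlUV (LatticeGapInUVUnitsC)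
open Summit.QuantumFields.YangMills.Theorems.LatticeGapInUVUnits.Negative (axisCov)
open Summit.QuantumFields.YangMills.Theorems.LatticeGapInUVUnitsC.Negative (shape_tendsto_zero_nhdsGT_of_continuous)

noncomputable section

namespace Summit.QuantumFields.YangMills.Theorems.LatticeGapInUVUnitsC.AmplitudeCriterion

/-- **The crux is equivalent to the fed a-free certificate (point-of-use strength certificate of branch 3).**
`LatticeGapInUVUnitsC` ↔ for every compact simple `G`, faithful `r` and CONTINUOUS unit map `a` carrying the femto
two-point package, and every threshold `u > 0`, there are `κ > 0`, `β₂`, a volume threshold `S₁ : ℝ → ℕ` and per-pair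
constants `C(A, B)` such that for `β ≥ β₂`, `N ≥ 1`: amplitude `N⁸ Cov_{β,(ℤ/8N)⁴}(P_0^{01}, P_{N e₂}^{01}) ≥ u` ⇒
`|corr_β^{(2S+1)}(A, B; t)| ≤ C e^{−κ t/N}` for all `S ≥ S₁ β`, `t ≤ S`.  `⇐`: seed (p122527) + transfer with the free
threshold; `⇒`: the crux's rate `c₁ a β` dominates `κ/N`, `κ = c₁ min(s₀(u), ℓ₀/8)`, since a certified amplitude inside
the femto window has `u ≤ C Γ(N a β)` (upper axis clause at `L = 8N`) and `Γ < u/(|C|+1)` on `(0, s₀)` (tightness). -/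
theorem latticeGapInUVUnitsC_iff_fedCertificate : LatticeGapInUVUnitsC ↔ ∀ (G : Type) [Group G] [TopologicalSpace G] [IsTopologicalGroup G] [CompactSpace G], IsCompactSimpleLieGroup G → letI : MeasurableSpace G := borel G; haveI : BorelSpace G := ⟨rfl⟩; ∀ (r : LatticeRep G) (a : ℝ → ℝ), Continuous a → (∃ (Γ : ℝ → ℝ) (β₀ ℓ₀ c C : ℝ), 0 < ℓ₀ ∧ 0 < c ∧ (∀ β, 0 < a β) ∧ Filter.Tendsto a Filter.atTop (nhds 0) ∧ (∀ s : ℝ, 0 < s → s ≤ ℓ₀ → 0 < Γ s ∧ Γ s ≤ 1) ∧ ∀ (L : ℕ) [NeZero L] (β : ℝ), β₀ ≤ β → (L : ℝ) * a β ≤ ℓ₀ → let P : (Fin 4 → ZMod L) → Fin 4 → Fin 4 → GaugeConfig 4 L G → ℝ := fun x i j U => (r.N : ℝ) - (r.ρ (plaquetteHolonomy U x i j)).trace.re; let E : (GaugeConfig 4 L G → ℝ) → ℝ := fun F => wilsonExpectation (d := 4) (L := L) r.ρ β F; let cov : (GaugeConfig 4 L G → ℝ) → (GaugeConfig 4 L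 G → ℝ) → ℝ := fun F F' => E (fun U => F U * F' U) - E F * E F'; let dist : (Fin 4 → ZMod L) → (Fin 4 → ZMod L) → ℝ := fun x y => Real.sqrt (∑ k : Fin 4, (((x k - y k).valMinAbs : ℤ) : ℝ) ^ 2); (∀ n : ℕ, 1 ≤ n → 8 * n ≤ L → c * Γ ((n : ℝ) * a β) ≤ (n : ℝ) ^ 8 * cov (P 0 0 1) (P (Pi.single (2 : Fin 4) ((n : ℕ) : ZMod L)) 0 1) ∧ (n : ℝ) ^ 8 * cov (P 0 0 1) (P (Pi.single (2 : Fin 4) ((n : ℕ) : ZMod L)) 0 1) ≤ C * Γ ((n : ℝ) * a β)) ∧ (∀ (x y : Fin 4 → ZMod L) (i j i' j' : Fin 4), x ≠ y → i ≠ j → i' ≠ j' → |cov (P x i j) (P y i' j')| * dist x y ^ 8 ≤ C * Γ (dist x y * a β))) → ∀ u : ℝ, 0 < u → ∃ (κ β₂ : ℝ) (S₁ : ℝ → ℕ), 0 < κ ∧ ∀ A B : YMSpecies G, ∃ C : ℝ, ∀ β : ℝ, β₂ ≤ β → ∀ (N : ℕ) [NeZero (8 * N)], 1 ≤ N → u ≤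 ((N : ℕ) : ℝ) ^ 8 * (wilsonExpectation r.ρ β (fun U : GaugeConfig 4 (8 * N) G => ((r.N : ℝ) - (r.ρ (plaquetteHolonomy U 0 0 1)).trace.re) * ((r.N : ℝ) - (r.ρ (plaquetteHolonomy U (Pi.single (2 : Fin 4) ((N : ℕ) : ZMod (8 * N))) 0 1)).trace.re)) - wilsonExpectation r.ρ β (fun U : GaugeConfig 4 (8 * N) G => (r.N : ℝ) - (r.ρ (plaquetteHolonomy U 0 0 1)).trace.re) * wilsonExpectation r.ρ β (fun U : GaugeConfig 4 (8 * N) G => (r.N : ℝ) - (r.ρ (plaquetteHolonomy U (Pi.single (2 : Fin 4) ((N : ℕ) : ZMod (8 * N))) 0 1)).trace.re)) → ∀ S t : ℕ, S₁ β ≤ S → t ≤ S → |latticeConnectedCorr r.ρ β (2 * S + 1) A.F B.F t| ≤ C * Real.exp (-(κ * t / N)) := by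
  constructor
  · -- `⇒`: the crux's conclusion dominates the certificate's rate at every certified scale
    intro hX G _ _ _ _ hG
    letI : MeasurableSpace G := borel G
    haveI : BorelSpace G := ⟨rfl⟩
    intro r a ha hP u hu
    obtain ⟨c₁, β₂, S₁, hc₁, hconcl⟩ := hX G hG r a ha hP
    obtain ⟨Γ, β₀, ℓ₀, c, C, hℓ₀, hc, hpos, hlim, hΓ, hbox⟩ := hP
    -- tightness `Γ(0⁺) = 0` (landed, from the LOWER axis clause at `L = 8`, `n = 1`)
    haveI : NeZero (8 : ℕ) := ⟨by norm_num⟩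
    have htight : Tendsto Γ (𝓝[>] 0) (𝓝 0) := by
      refine shape_tendsto_zero_nhdsGT_of_continuous r hc hℓ₀ ha hpos hlim
        (fun s hs hsℓ => (hΓ s hs hsℓ).1.le) (β₀ := β₀) fun β hβ h8 => ?_
      have hL : ((8 : ℕ) : ℝ) * a β ≤ ℓ₀ := by push_cast; exact h8
      obtain ⟨hax, -⟩ := hbox 8 β hβ hL
      obtain ⟨h, -⟩ := hax 1 le_rfl (by norm_num)
      have h' : c * Γ (((1 : ℕ) : ℝ) * a β) ≤ ((1 : ℕ) : ℝ) ^ 8 * axisCov r 8 β 1 := h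
      simpa using h'
    -- the scale `s₀(u)`: `Γ < u / (|C| + 1)` on `(0, s₀)`
    obtain ⟨s₀, hs₀, hsmall⟩ := Metric.tendsto_nhdsWithin_nhds.1 htight (u / (|C| + 1)) (by positivity)
    refine ⟨c₁ * min s₀ (ℓ₀ / 8), max β₀ β₂, S₁, by positivity, fun A B => ?_⟩
    obtain ⟨C', hC'⟩ := hconcl A B
    refine ⟨max C' 0, fun β hβ N _ hN1 hamp S t hS ht => ?_⟩
    have hβ₀ : β₀ ≤ β := (le_max_left _ _).trans hβ
    have hβ₂ : β₂ ≤ β := (le_max_right _ _).trans hβ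
    have hclust := hC' β hβ₂ S t hS ht
    have ha := hpos β
    have hNpos : (0 : ℝ) < (N : ℝ) := by exact_mod_cast hN1
    have ht0 : (0 : ℝ) ≤ t := Nat.cast_nonneg t
    -- key placement: `min(s₀, ℓ₀/8) ≤ N a β` at every certified scale
    have key : min s₀ (ℓ₀ / 8) ≤ (N : ℝ) * a β := by
      by_cases h8 : 8 * ((N : ℝ) * a β) ≤ ℓ₀
      · -- inside the femto window: UPPER axis clause at `L = 8N`, `n = N`, then tightness
        have hL : ((8 * N : ℕ) : ℝ) * a β ≤ ℓ₀ := by push_cast; linarith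
        obtain ⟨hax, -⟩ := hbox (8 * N) β hβ₀ hL
        have hup := (hax N hN1 le_rfl).2
        have hu_le : u ≤ C * Γ ((N : ℝ) * a β) := le_trans hamp hup
        have hNa : 0 < (N : ℝ) * a β := by positivity
        have hΓpos : 0 < Γ ((N : ℝ) * a β) := (hΓ _ hNa (by linarith)).1
        refine (min_le_left _ _).trans ?_
        by_contra hcon
        push Not at hcon
        have hd := hsmall (x := (N : ℝ) * a β) hNa (by rwa [Real.dist_eq, sub_zero, abs_of_pos hNa])
        rw [Real.dist_eq, sub_zero, abs_of_pos hΓpos] at hd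
        have h1 : C * Γ ((N : ℝ) * a β) ≤ |C| * Γ ((N : ℝ) * a β) :=
          mul_le_mul_of_nonneg_right (le_abs_self C) hΓpos.le
        have hC0 : 0 ≤ |C| := abs_nonneg C
        have h2 : |C| * Γ ((N : ℝ) * a β) ≤ (|C| + 1) * Γ ((N : ℝ) * a β) :=
          mul_le_mul_of_nonneg_right (by linarith) hΓpos.le
        have h3 : (|C| + 1) * Γ ((N : ℝ) * a β) < (|C| + 1) * (u / (|C| + 1)) :=
          mul_lt_mul_of_pos_left hd (by positivity)
        have h4 : (|C| + 1) * (u / (|C| + 1)) = u := by field_simp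
        linarith
      · push Not at h8
        refine (min_le_right _ _).trans ?_
        linarith
    have hrate : c₁ * min s₀ (ℓ₀ / 8) * t / N ≤ c₁ * a β * t := by
      rw [div_le_iff₀ hNpos]
      calc c₁ * min s₀ (ℓ₀ / 8) * t = (c₁ * t) * min s₀ (ℓ₀ / 8) := by ring
        _ ≤ (c₁ * t) * ((N : ℝ) * a β) := mul_le_mul_of_nonneg_left key (by positivity)
        _ = c₁ * a β * t * N := by ring
    calc |latticeConnectedCorr r.ρ β (2 * S + 1) A.F B.F t| ≤ C' * Real.exp (-(c₁ * a β * t)) := hclust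
      _ ≤ max C' 0 * Real.exp (-(c₁ * a β * t)) :=
          mul_le_mul_of_nonneg_right (le_max_left _ _) (Real.exp_pos _).le
      _ ≤ max C' 0 * Real.exp (-(c₁ * min s₀ (ℓ₀ / 8) * t / N)) :=
          mul_le_mul_of_nonneg_left (Real.exp_le_exp.2 (neg_le_neg hrate)) (le_max_right _ _)
  · -- `⇐`: seed (landed) + transfer with the free volume threshold
    intro hF G _ _ _ _ hG
    letI : MeasurableSpace G := borel G
    haveI : BorelSpace G := ⟨rfl⟩
    intro r a ha hP
    have hF' := hF G hG r a ha hP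
    obtain ⟨Γ, β₀, ℓ₀, c, C, hℓ₀, hc, hpos, hlim, hΓ, hbox⟩ := hP
    obtain ⟨umin, humin, hseed⟩ :=
      Summit.QuantumFields.YangMills.Theorems.LatticeGapInUVUnitsC.AmplitudeRatchet.stub_seed G r a Γ β₀ ℓ₀ c C ha
        hℓ₀ hc hpos hlim hΓ hbox
    obtain ⟨κ, β₂, S₁, hκ, hcert⟩ := hF' umin humin
    -- `a β < ℓ₀ / 16` eventually
    have h16 : (0 : ℝ) < ℓ₀ / 16 := by positivity
    obtain ⟨β₄, hβ₄⟩ := eventually_atTop.1 (hlim (Iio_mem_nhds h16))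
    refine ⟨8 * κ / ℓ₀, max (max β₀ β₂) β₄, S₁, by positivity, fun A B => ?_⟩
    obtain ⟨C', hC'⟩ := hcert A B
    refine ⟨max C' 0, fun β hβ S t hS ht => ?_⟩
    have hβ₀ : β₀ ≤ β := ((le_max_left _ _).trans (le_max_left _ _)).trans hβ
    have hβ₂ : β₂ ≤ β := ((le_max_right _ _).trans (le_max_left _ _)).trans hβ
    have haℓ : a β < ℓ₀ / 16 := hβ₄ β ((le_max_right _ _).trans hβ)
    have ha := hpos β
    -- the scale `N(β) = ⌈ℓ₀ / (16 a β)⌉₊` lies in the seed's octave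
    set N : ℕ := ⌈ℓ₀ / (16 * a β)⌉₊ with hNdef
    have hq : 0 < ℓ₀ / (16 * a β) := by positivity
    have hN1 : 1 ≤ N := Nat.one_le_iff_ne_zero.2 (Nat.ceil_pos.2 hq).ne'
    haveI : NeZero (8 * N) := ⟨by omega⟩
    have hNge : ℓ₀ / (16 * a β) ≤ (N : ℝ) := Nat.le_ceil _
    have hNlt : (N : ℝ) < ℓ₀ / (16 * a β) + 1 := Nat.ceil_lt_add_one hq.le
    have hwin1 : ℓ₀ ≤ 16 * ((N : ℝ) * a β) := by
      have h1 : ℓ₀ / (16 * a β) * (16 * a β) = ℓ₀ := div_mul_cancel₀ ℓ₀ (by positivity)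
      nlinarith
    have hwin2 : 8 * ((N : ℝ) * a β) ≤ ℓ₀ := by
      have h1 : (ℓ₀ / (16 * a β) + 1) * (16 * a β) = ℓ₀ + 16 * a β := by
        rw [add_mul, one_mul, div_mul_cancel₀ ℓ₀ (by positivity)]
      nlinarith
    -- the seed: amplitude `≥ umin` at `(β, N)`; the certificate fires on all tori `S ≥ S₁ β`
    have hamp := hseed β hβ₀ N hwin1 hwin2
    have hclust := hC' β hβ₂ N hN1 hamp S t hS ht
    -- rate comparison: `(8κ/ℓ₀) a β t ≤ κ t / N` from `8 N a β ≤ ℓ₀`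
    have hNpos : (0 : ℝ) < (N : ℝ) := by exact_mod_cast hN1
    have ht0 : (0 : ℝ) ≤ t := Nat.cast_nonneg t
    have hrate : 8 * κ / ℓ₀ * a β ≤ κ / (N : ℝ) := by
      rw [div_mul_eq_mul_div, div_le_div_iff₀ hℓ₀ hNpos]
      calc 8 * κ * a β * (N : ℝ) = κ * (8 * ((N : ℝ) * a β)) := by ring
        _ ≤ κ * ℓ₀ := mul_le_mul_of_nonneg_left hwin2 hκ.le
    have key : 8 * κ / ℓ₀ * a β * t ≤ κ * t / (N : ℝ) :=
      calc 8 * κ / ℓ₀ * a β * t ≤ κ / (N : ℝ) * t := mul_le_mul_of_nonneg_right hrate ht0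
        _ = κ * t / (N : ℝ) := by ring
    calc |latticeConnectedCorr r.ρ β (2 * S + 1) A.F B.F t| ≤ C' * Real.exp (-(κ * t / N)) := hclust
      _ ≤ max C' 0 * Real.exp (-(κ * t / N)) :=
          mul_le_mul_of_nonneg_right (le_max_left _ _) (Real.exp_pos _).le
      _ ≤ max C' 0 * Real.exp (-(8 * κ / ℓ₀ * a β * t)) :=
          mul_le_mul_of_nonneg_left (Real.exp_le_exp.2 (neg_le_neg key)) (le_max_right _ _)

end Summit.QuantumFields.YangMills.Theorems.LatticeGapInUVUnitsC.AmplitudeCriterion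

end
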